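import Summits.AtomisticToContinuum.FouriersLaw.Theses.EmbeddedDrudeMourre
import Summits.AtomisticToContinuum.FouriersLaw.Theorems.FGRGap.Negative.OnsiteReduction
import Literature.MathematicalPhysics.KineticTheory.PinnedChainResonantFinite
import Literature.Analysis.Calculus.SubmersionNullPreimage

/-!
# FGRGap, line `fold-jet-rigidity`, stub S4a (`stub_formLowerSemicontinuous`) — file B:
# null-set geometry of the partner map

Support for the registered stub `stub_formLowerSemicontinuous` of crux `EmbeddedDrudeMourre.FGRGap`
(item stmt-AtomisticToContinuum-12595). With `v = groupVelocity ω₂` (`ω₂ > 0`):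

* `volume_setOf_groupVelocity_eq`: the EQUAL-VELOCITY CURVE `{(k₁,k₃) | v k₃ = v k₁}` is
  Lebesgue-null in `ℝ²` (every fibre is the zero set of the non-constant real-analytic
  `v - v(k₁)`, hence countable; Tonelli).
* `volume_setOf_partner_mem`: given the local analytic lifts `φ ≡ h (mod 2π)` of a partner map `h`
  off that curve with the implicit derivative `Dφ = ((v₄-v₁)dk₁ + (v₃-v₄)dk₃)/(v₂-v₄)` (the
  conclusion of the structural stub `stub_branchStructure`, taken as a hypothesis), the pull-backs
  `{p | h p ∈ N}` and `{p | p.1 + h p - p.2 ∈ N}` of every `2πℤ`-invariant null set `N ⊆ ℝ` are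
  null: `φ` and `κ = k₁ + φ - k₃` are SUBMERSIONS off the curve (`Dφ = 0` or `Dκ = 0` would force
  `v₃ = v₁`), so `Literature.Analysis.Calculus.exists_nhds_measure_inter_preimage_null` applies
  locally, and countably many lift neighbourhoods cover the open complement of the curve.
* `volume_setOf_fst_mem_and_snd_mem`, `volume_setOf_not_tendsto`: products with a null factor;
  the exceptional set of an a.e.-convergent (on the cell) sequence of `2π`-periodic
  functions is `2πℤ`-invariant and null on `ℝ`.
-/

noncomputable section

open MeasureTheory Set Real Filter Topology
open scoped ENNReal
open Literature.MathematicalPhysics.KineticTheory.PhononBoltzmann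
open Summit.AtomisticToContinuum.FouriersLaw.Theorems.FGRGap

namespace Summit.AtomisticToContinuum.FouriersLaw.Theorems.FGRGap.FoldJetRigidity.Lsc

/-! ## The equal-velocity curve is null -/

/-- The group velocity `v = sin/ω` is real-analytic (`ω₂ > 0`). [folklore] -/
theorem analyticAt_groupVelocity {ω₂ : ℝ} (hω : 0 < ω₂) (k : ℝ) :
    AnalyticAt ℝ (groupVelocity ω₂) k := by
  have h : AnalyticAt ℝ (fun k => Real.sin k / dispersion ω₂ k) k :=
    Real.analyticAt_sin.div (analyticAt_dispersion hω k) (dispersion_pos hω k).ne'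
  exact h

/-- The group velocity is continuous (`ω₂ > 0`). [folklore] -/
theorem continuous_groupVelocity {ω₂ : ℝ} (hω : 0 < ω₂) : Continuous (groupVelocity ω₂) :=
  continuous_iff_continuousAt.2 fun k => (analyticAt_groupVelocity hω k).continuousAt

/-- `v(π/2) ≠ v(-π/2)` (`v` is odd with `v(π/2) = 1/ω(π/2) > 0`): `v` is not constant. [folklore] -/
theorem groupVelocity_pi_div_two_ne {ω₂ : ℝ} (hω : 0 < ω₂) :
    groupVelocity ω₂ (π / 2) ≠ groupVelocity ω₂ (-(π / 2)) := by
  rw [groupVelocity_neg]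
  have hpos : 0 < groupVelocity ω₂ (π / 2) := by
    unfold groupVelocity
    rw [Real.sin_pi_div_two]
    exact div_pos one_pos (dispersion_pos hω _)
  intro h
  linarith

/-- Every level set `{k₃ | v k₃ = c}` of the group velocity is countable (`ω₂ > 0`): `v - c` is a
real-analytic function on `ℝ` which is not identically zero, so its zeros in each `[m, m+1]` are
finite. [folklore] -/
theorem countable_setOf_groupVelocity_eq {ω₂ : ℝ} (hω : 0 < ω₂) (c : ℝ) :
    {k₃ : ℝ | groupVelocity ω₂ k₃ = c}.Countable := by
  have han : ∀ x, AnalyticAt ℝ (fun k => groupVelocity ω₂ k - c) x :=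
    fun x => (analyticAt_groupVelocity hω x).sub analyticAt_const
  obtain ⟨x₀, hx₀⟩ : ∃ x₀, groupVelocity ω₂ x₀ - c ≠ 0 := by
    by_cases h : groupVelocity ω₂ (π / 2) - c = 0
    · exact ⟨-(π / 2), fun h' => groupVelocity_pi_div_two_ne hω (by linarith)⟩
    · exact ⟨π / 2, h⟩
  have hcov : {k₃ : ℝ | groupVelocity ω₂ k₃ = c} ⊆
      ⋃ m : ℤ, {x | x ∈ Icc (m : ℝ) (m + 1) ∧ groupVelocity ω₂ x - c = 0} := by
    intro x hx
    refine mem_iUnion.2 ⟨⌊x⌋, ⟨Int.floor_le x, (Int.lt_floor_add_one x).le⟩, ?_⟩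
    have hx' : groupVelocity ω₂ x = c := hx
    rw [hx', sub_self]
  refine Set.Countable.mono hcov (Set.countable_iUnion fun m => ?_)
  exact (finite_zeros_of_analyticAt han hx₀ isCompact_Icc).countable

/-- **The equal-velocity curve is Lebesgue-null**: `volume {(k₁,k₃) | v k₃ = v k₁} = 0` for
`ω₂ > 0` (closed set with countable fibres; Tonelli). [folklore] -/
theorem volume_setOf_groupVelocity_eq {ω₂ : ℝ} (hω : 0 < ω₂) :
    volume {p : ℝ × ℝ | groupVelocity ω₂ p.2 = groupVelocity ω₂ p.1} = 0 := by
  have hc := continuous_groupVelocity hω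
  have hE : MeasurableSet {p : ℝ × ℝ | groupVelocity ω₂ p.2 = groupVelocity ω₂ p.1} :=
    (isClosed_eq (hc.comp continuous_snd) (hc.comp continuous_fst)).measurableSet
  rw [Measure.volume_eq_prod, Measure.measure_prod_null hE]
  refine Filter.Eventually.of_forall fun k₁ => ?_
  exact (countable_setOf_groupVelocity_eq hω (groupVelocity ω₂ k₁)).measure_zero volume

/-! ## Products with a null factor; the exceptional set of an a.e.-convergent periodic sequence -/

/-- Both coordinate pull-backs `{p | p.1 ∈ N}` and `{p | p.2 ∈ N}` of a null `N ⊆ ℝ` are null in `ℝ²`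
(products with a null factor). [folklore] -/
theorem volume_setOf_fst_mem_and_snd_mem {N : Set ℝ} (hN : volume N = 0) :
    volume {p : ℝ × ℝ | p.1 ∈ N} = 0 ∧ volume {p : ℝ × ℝ | p.2 ∈ N} = 0 := by
  have h1 : {p : ℝ × ℝ | p.1 ∈ N} = N ×ˢ (univ : Set ℝ) := by
    rw [Set.prod_univ]
    rfl
  have h2 : {p : ℝ × ℝ | p.2 ∈ N} = (univ : Set ℝ) ×ˢ N := by
    rw [Set.univ_prod]
    rfl
  rw [h1, h2, Measure.volume_eq_prod, Measure.prod_prod, Measure.prod_prod, hN, zero_mul, mul_zero]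
  exact ⟨rfl, rfl⟩

/-- For `2π`-periodic `F n`, `f` converging a.e. ON THE CELL `(-π, π]`, the exceptional set
`{x | F n x ↛ f x}` is null on all of `ℝ` (countably many translates of its trace on the cell)
and invariant under `2πℤ`-shifts. [folklore] -/
theorem volume_setOf_not_tendsto {F : ℕ → ℝ → ℝ} {f : ℝ → ℝ}
    (hFper : ∀ n, Function.Periodic (F n) (2 * π)) (hfper : Function.Periodic f (2 * π))
    (hae : ∀ᵐ k ∂(volume.restrict (Ioc (-π) π)), Tendsto (fun n => F n k) atTop (𝓝 (f k))) :
    volume {x : ℝ | ¬Tendsto (fun n => F n x) atTop (𝓝 (f x))} = 0 ∧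
      ∀ (x : ℝ) (m : ℤ), x ∈ {x : ℝ | ¬Tendsto (fun n => F n x) atTop (𝓝 (f x))} →
        x + m * (2 * π) ∈ {x : ℝ | ¬Tendsto (fun n => F n x) atTop (𝓝 (f x))} := by
  set N := {x : ℝ | ¬Tendsto (fun n => F n x) atTop (𝓝 (f x))} with hN
  have hinv : ∀ (x : ℝ) (m : ℤ), x ∈ N ↔ x + m * (2 * π) ∈ N := by
    intro x m
    simp only [hN, mem_setOf_eq]
    have h1 : (fun n => F n (x + m * (2 * π))) = fun n => F n x :=
      funext fun n => (hFper n).int_mul m x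
    rw [h1, (hfper.int_mul m) x]
  refine ⟨?_, fun x m hx => (hinv x m).1 hx⟩
  have hcell : volume (N ∩ Ioc (-π) π) = 0 := by
    have h := hae
    rw [ae_iff, Measure.restrict_apply' measurableSet_Ioc] at h
    exact h
  have hcov : N ⊆ ⋃ m : ℤ, (fun x => x + m * (2 * π)) ⁻¹' (N ∩ Ioc (-π) π) := by
    intro x hx
    refine mem_iUnion.2 ⟨-toIocDiv Real.two_pi_pos (-π) x, (hinv x _).1 hx, ?_⟩
    have e : x + ((-toIocDiv Real.two_pi_pos (-π) x : ℤ) : ℝ) * (2 * π) =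
        toIocMod Real.two_pi_pos (-π) x := by
      rw [← self_sub_toIocDiv_zsmul, zsmul_eq_mul]
      push_cast
      ring
    have hm := toIocMod_mem_Ioc Real.two_pi_pos (-π) x
    rw [show -π + 2 * π = π by ring] at hm
    show x + ((-toIocDiv Real.two_pi_pos (-π) x : ℤ) : ℝ) * (2 * π) ∈ Ioc (-π) π
    rw [e]
    exact hm
  refine measure_mono_null hcov (measure_iUnion_null fun m => ?_)
  rw [measure_preimage_add_right]
  exact hcell

/-! ## Pull-backs by the partner map and by `k₄` -/

/-- A continuous linear functional on `ℝ²` which does not kill both basis vectors is onto.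
[folklore] -/
theorem range_eq_top_of_apply_ne_zero {T : ℝ × ℝ →L[ℝ] ℝ} (hT : T (1, 0) ≠ 0 ∨ T (0, 1) ≠ 0) :
    LinearMap.range (T : ℝ × ℝ →ₗ[ℝ] ℝ) = ⊤ := by
  refine LinearMap.range_eq_top.2 fun y => ?_
  rcases hT with h | h
  · refine ⟨(y / T (1, 0)) • ((1 : ℝ), (0 : ℝ)), ?_⟩
    rw [ContinuousLinearMap.coe_coe, map_smul, smul_eq_mul, div_mul_cancel₀ y h]
  · refine ⟨(y / T (0, 1)) • ((0 : ℝ), (1 : ℝ)), ?_⟩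
    rw [ContinuousLinearMap.coe_coe, map_smul, smul_eq_mul, div_mul_cancel₀ y h]

/-- Implicit derivatives of the partner map: `∂₁φ = (v₄-v₁)/(v₂-v₄)` and `∂₃φ = (v₃-v₄)/(v₂-v₄)`
cannot both vanish off the equal-velocity curve (`v₂ ≠ v₄`, `v₃ ≠ v₁`). [folklore] -/
theorem partials_ne_zero {v₁ v₂ v₃ v₄ : ℝ} (h13 : v₃ ≠ v₁) (hd : v₂ - v₄ ≠ 0) :
    (v₄ - v₁) / (v₂ - v₄) ≠ 0 ∨ (v₃ - v₄) / (v₂ - v₄) ≠ 0 := by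
  by_contra hcon
  push Not at hcon
  obtain ⟨h1, h2⟩ := hcon
  rw [div_eq_zero_iff, or_iff_left hd, sub_eq_zero] at h1 h2
  exact h13 (h2.trans h1)

/-- Implicit derivatives of `k₄ = k₁ + φ - k₃`: `∂₁k₄ = 1 + ∂₁φ` and `∂₃k₄ = ∂₃φ - 1` cannot both
vanish off the equal-velocity curve. [folklore] -/
theorem partials_k₄_ne_zero {v₁ v₂ v₃ v₄ : ℝ} (h13 : v₃ ≠ v₁) (hd : v₂ - v₄ ≠ 0) :
    1 + (v₄ - v₁) / (v₂ - v₄) ≠ 0 ∨ (v₃ - v₄) / (v₂ - v₄) - 1 ≠ 0 := by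
  by_contra hcon
  push Not at hcon
  obtain ⟨h1, h2⟩ := hcon
  field_simp at h1 h2
  apply h13
  linarith

/-- **Pull-backs of `2πℤ`-invariant null sets by the partner map `h` and by `k₄ = k₁ + h - k₃` are
null.** Hypotheses: off the equal-velocity curve the resolved Jacobian is not junk
(`v(h) ≠ v(k₄)`) and `h` has local real-analytic lifts `φ ≡ h (mod 2π)` with
`Dφ = ((v₄-v₁) dk₁ + (v₃-v₄) dk₃)/(v₂-v₄)`. Then `φ` and `κ = k₁ + φ - k₃` are `C¹` submersions
near every point off the curve (a vanishing differential would force `v₃ = v₁`), so they pull null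
sets back to null sets (`Literature.Analysis.Calculus.exists_nhds_measure_inter_preimage_null`);
`{h ∈ N} = {φ ∈ N}` and `{k₄ ∈ N} = {κ ∈ N}` locally by invariance of `N`; countably many such
neighbourhoods cover the complement of the null curve. [folklore] -/
theorem volume_setOf_partner_mem {ω₂ : ℝ} (hω : 0 < ω₂) {h : ℝ → ℝ → ℝ}
    (hjac : ∀ k₁ k₃ : ℝ, groupVelocity ω₂ k₃ ≠ groupVelocity ω₂ k₁ →
      groupVelocity ω₂ (h k₁ k₃) ≠ groupVelocity ω₂ (k₁ + h k₁ k₃ - k₃))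
    (hlift : ∀ k₁ k₃ : ℝ, groupVelocity ω₂ k₃ ≠ groupVelocity ω₂ k₁ →
      ∃ (φ : ℝ × ℝ → ℝ) (U : Set (ℝ × ℝ)), U ∈ 𝓝 (k₁, k₃) ∧ AnalyticOnNhd ℝ φ U ∧
        φ (k₁, k₃) = h k₁ k₃ ∧ (∀ p ∈ U, ∃ n : ℤ, φ p = h p.1 p.2 + n * (2 * π)) ∧
        (∀ p ∈ U, groupVelocity ω₂ p.2 ≠ groupVelocity ω₂ p.1) ∧
        (∀ p ∈ U, HasStrictFDerivAt φ
          (((groupVelocity ω₂ (p.1 + φ p - p.2) - groupVelocity ω₂ p.1) /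
              (groupVelocity ω₂ (φ p) - groupVelocity ω₂ (p.1 + φ p - p.2))) •
              ContinuousLinearMap.fst ℝ ℝ ℝ +
            ((groupVelocity ω₂ p.2 - groupVelocity ω₂ (p.1 + φ p - p.2)) /
              (groupVelocity ω₂ (φ p) - groupVelocity ω₂ (p.1 + φ p - p.2))) •
              ContinuousLinearMap.snd ℝ ℝ ℝ) p))
    {N : Set ℝ} (hN : volume N = 0) (hNinv : ∀ (x : ℝ) (m : ℤ), x ∈ N → x + m * (2 * π) ∈ N) :
    volume {p : ℝ × ℝ | h p.1 p.2 ∈ N} = 0 ∧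
      volume {p : ℝ × ℝ | p.1 + h p.1 p.2 - p.2 ∈ N} = 0 := by
  -- the local statement near every point off the equal-velocity curve
  have hloc : ∀ p ∈ {p : ℝ × ℝ | groupVelocity ω₂ p.2 ≠ groupVelocity ω₂ p.1},
      ∃ W ∈ 𝓝[{p : ℝ × ℝ | groupVelocity ω₂ p.2 ≠ groupVelocity ω₂ p.1}] p,
        volume (W ∩ {q : ℝ × ℝ | h q.1 q.2 ∈ N}) = 0 ∧
          volume (W ∩ {q : ℝ × ℝ | q.1 + h q.1 q.2 - q.2 ∈ N}) = 0 := by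
    rintro ⟨k₁, k₃⟩ hp
    obtain ⟨φ, U, hU, hφan, -, hφlift, -, hφder⟩ := hlift k₁ k₃ hp
    have hpU : (k₁, k₃) ∈ U := mem_of_mem_nhds hU
    obtain ⟨n₀, hn₀⟩ := hφlift _ hpU
    have hder := hφder _ hpU
    dsimp only at hder hn₀
    -- the resolved Jacobian at the base point is not junk
    have hd : groupVelocity ω₂ (φ (k₁, k₃)) - groupVelocity ω₂ (k₁ + φ (k₁, k₃) - k₃) ≠ 0 := by
      have hv2 : groupVelocity ω₂ (φ (k₁, k₃)) = groupVelocity ω₂ (h k₁ k₃) := by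
        rw [hn₀]
        exact (groupVelocity_periodic ω₂).int_mul n₀ _
      have hv4 : groupVelocity ω₂ (k₁ + φ (k₁, k₃) - k₃) =
          groupVelocity ω₂ (k₁ + h k₁ k₃ - k₃) := by
        rw [hn₀, show k₁ + (h k₁ k₃ + n₀ * (2 * π)) - k₃ = k₁ + h k₁ k₃ - k₃ + n₀ * (2 * π) by ring]
        exact (groupVelocity_periodic ω₂).int_mul n₀ _
      rw [hv2, hv4]
      exact sub_ne_zero.2 (hjac k₁ k₃ hp)
    -- `φ` is a `C¹` submersion at the base point
    have hC1φ : ContDiffAt ℝ 1 φ (k₁, k₃) := (hφan _ hpU).contDiffAt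
    have hsurjφ : LinearMap.range (fderiv ℝ φ (k₁, k₃) : ℝ × ℝ →ₗ[ℝ] ℝ) = ⊤ := by
      rw [hder.hasFDerivAt.fderiv]
      apply range_eq_top_of_apply_ne_zero
      simpa using partials_ne_zero hp hd
    obtain ⟨V₁, hV₁, hV₁null⟩ :=
      Literature.Analysis.Calculus.exists_nhds_measure_inter_preimage_null volume volume φ hC1φ
        hsurjφ
    -- `κ = k₁ + φ - k₃` is a `C¹` submersion at the base point
    have hC1κ : ContDiffAt ℝ 1 (fun q : ℝ × ℝ => q.1 + φ q - q.2) (k₁, k₃) :=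
      (contDiffAt_fst.add hC1φ).sub contDiffAt_snd
    have hsurjκ : LinearMap.range
        (fderiv ℝ (fun q : ℝ × ℝ => q.1 + φ q - q.2) (k₁, k₃) : ℝ × ℝ →ₗ[ℝ] ℝ) = ⊤ := by
      rw [((hasFDerivAt_fst.fun_add hder.hasFDerivAt).fun_sub hasFDerivAt_snd).fderiv]
      apply range_eq_top_of_apply_ne_zero
      simpa using partials_k₄_ne_zero hp hd
    obtain ⟨V₂, hV₂, hV₂null⟩ :=
      Literature.Analysis.Calculus.exists_nhds_measure_inter_preimage_null volume volume
        (fun q : ℝ × ℝ => q.1 + φ q - q.2) hC1κ hsurjκ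
    refine ⟨U ∩ (V₁ ∩ V₂), mem_nhdsWithin_of_mem_nhds (inter_mem hU (inter_mem hV₁ hV₂)), ?_, ?_⟩
    · refine measure_mono_null ?_ (hV₁null N hN)
      rintro q ⟨⟨hqU, hqV₁, -⟩, hqN⟩
      obtain ⟨n, hn⟩ := hφlift q hqU
      refine ⟨hqV₁, ?_⟩
      show φ q ∈ N
      rw [hn]
      exact hNinv _ n hqN
    · refine measure_mono_null ?_ (hV₂null N hN)
      rintro q ⟨⟨hqU, -, hqV₂⟩, hqN⟩
      obtain ⟨n, hn⟩ := hφlift q hqU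
      refine ⟨hqV₂, ?_⟩
      show q.1 + φ q - q.2 ∈ N
      rw [hn, show q.1 + (h q.1 q.2 + n * (2 * π)) - q.2 = q.1 + h q.1 q.2 - q.2 + n * (2 * π) by
        ring]
      exact hNinv _ n hqN
  -- countably many such neighbourhoods cover the complement of the (null) curve
  choose! W hW hWnull using hloc
  obtain ⟨T, hTO, hTc, hOT⟩ := TopologicalSpace.countable_cover_nhdsWithin hW
  have hE := volume_setOf_groupVelocity_eq hω
  have key : ∀ M : Set (ℝ × ℝ), (∀ p ∈ T, volume (W p ∩ M) = 0) → volume M = 0 := by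
    intro M hM
    refine measure_mono_null (t := {p : ℝ × ℝ | groupVelocity ω₂ p.2 = groupVelocity ω₂ p.1} ∪
      ⋃ p ∈ T, (W p ∩ M)) ?_ ?_
    · intro q hq
      by_cases hqE : groupVelocity ω₂ q.2 = groupVelocity ω₂ q.1
      · exact Or.inl hqE
      · obtain ⟨p, hpT, hqW⟩ := mem_iUnion₂.1 (hOT hqE)
        exact Or.inr (mem_iUnion₂.2 ⟨p, hpT, hqW, hq⟩)
    · exact measure_union_null hE ((measure_biUnion_null_iff hTc).2 hM)
  exact ⟨key _ fun p hp => (hWnull p (hTO hp)).1, key _ fun p hp => (hWnull p (hTO hp)).2⟩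

end Summit.AtomisticToContinuum.FouriersLaw.Theorems.FGRGap.FoldJetRigidity.Lsc

namespace Summit.AtomisticToContinuum.FouriersLaw.Theorems.FGRGap.FoldJetRigidity

/-- **Registered helper stub `stub_formLowerSemicontinuous_partB` (file B of S4a, line
`fold-jet-rigidity`).** For `ω₂ > 0` and a partner map `h` whose resolved Jacobian is not junk off the
equal-velocity curve and which has local real-analytic lifts `φ ≡ h (mod 2π)` there with the implicit
derivative `Dφ = ((v₄-v₁) dk₁ + (v₃-v₄) dk₃)/(v₂-v₄)`: the pull-backs `{p | h p ∈ N}` and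
`{p | p.1 + h p - p.2 ∈ N}` of every `2πℤ`-invariant Lebesgue-null `N ⊆ ℝ` are Lebesgue-null in `ℝ²`
(`Lsc.volume_setOf_partner_mem`). [folklore] -/
theorem stub_formLowerSemicontinuous_partB :
    ∀ ω₂ : ℝ, 0 < ω₂ → ∀ h : ℝ → ℝ → ℝ,
      (∀ k₁ k₃ : ℝ, groupVelocity ω₂ k₃ ≠ groupVelocity ω₂ k₁ →
          groupVelocity ω₂ (h k₁ k₃) ≠ groupVelocity ω₂ (k₁ + h k₁ k₃ - k₃)) →
      (∀ k₁ k₃ : ℝ, groupVelocity ω₂ k₃ ≠ groupVelocity ω₂ k₁ →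
          ∃ (φ : ℝ × ℝ → ℝ) (U : Set (ℝ × ℝ)), U ∈ 𝓝 (k₁, k₃) ∧ AnalyticOnNhd ℝ φ U ∧
            φ (k₁, k₃) = h k₁ k₃ ∧ (∀ p ∈ U, ∃ n : ℤ, φ p = h p.1 p.2 + n * (2 * π)) ∧
            (∀ p ∈ U, groupVelocity ω₂ p.2 ≠ groupVelocity ω₂ p.1) ∧
            (∀ p ∈ U, HasStrictFDerivAt φ (((groupVelocity ω₂ (p.1 + φ p - p.2) - groupVelocity ω₂ p.1) /
              (groupVelocity ω₂ (φ p) - groupVelocity ω₂ (p.1 + φ p - p.2))) • ContinuousLinearMap.fst ℝ ℝ ℝ +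
            ((groupVelocity ω₂ p.2 - groupVelocity ω₂ (p.1 + φ p - p.2)) /
              (groupVelocity ω₂ (φ p) - groupVelocity ω₂ (p.1 + φ p - p.2))) • ContinuousLinearMap.snd ℝ ℝ ℝ) p)) →
      ∀ N : Set ℝ, MeasureTheory.volume N = 0 → (∀ (x : ℝ) (m : ℤ), x ∈ N → x + m * (2 * π) ∈ N) →
        MeasureTheory.volume {p : ℝ × ℝ | h p.1 p.2 ∈ N} = 0 ∧
          MeasureTheory.volume {p : ℝ × ℝ | p.1 + h p.1 p.2 - p.2 ∈ N} = 0 :=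
  fun _ hω _ hjac hlift _ hN hNinv => Lsc.volume_setOf_partner_mem hω hjac hlift hN hNinv

end Summit.AtomisticToContinuum.FouriersLaw.Theorems.FGRGap.FoldJetRigidity

end
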